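import Summits.ResolutionOfSingularities.ResolutionOfSingularities.Theorems.HomologicalConductorNoZenoCaptureStep
import Summits.ResolutionOfSingularities.ResolutionOfSingularities.Theorems.HomologicalConductorNoZenoOrdValuation
import HarnessLib

/-!
# Crux `NoZeno` / `NoZenoR` (stmt-ResolutionOfSingularities-16483 / -19943), line `sandwich-cluster`:
# `basePts R T_(m+1) ⊆ basePts R T_m` — the ⊆ half of S4 `stub_basePtsStrictAnti`, literal form

Route `ResolutionOfSingularities/HomologicalConductor`.  OURS (cell res-hironaka); nothing here is a
statement of the manuscript under review.  In the vocabulary of the line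
(`Theorems/HomologicalConductorNoZenoSandwichClusterDefs.lean`: `basePts`, `Dominates`, `ordSet`,
`SandwichCtx`), stub S4 of line `sandwich-cluster` (CRUX-PLAN W4.4 v2 §2) asserts, under
(Q_val at `m`) — «`ca(T_m)` generates a principal ideal in every regular local `S ⊇ T_m`» — that the
base points strictly decrease: `basePts R T_(m+1) ⊂ basePts R T_m` (with, after the lead's v10
correction, `T_(m+1)` singular).  This file closes the INCLUSION («no new base point», CAPTURE):

* `basePts_tower_succ_subset` — for `k ⊆ O`, `A ⊆ O`, `Frac R = K` and (Q_val at `m`):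
  `basePts R (tower O A (m + 1)) ⊆ basePts R (tower O A m)`;
* `basePts_tower_succ_subset_of_sandwichCtx` — the same read off a `SandwichCtx O A R m₀`
  (no `m₀ + 1 ≤ m`, no non-emptiness and no singularity hypothesis are needed for this half).

Proof: `basePt_descends` (`…CaptureStep.lean`, the abstract form over any subsemiring `V`
dominating `S`) applied to the subsemiring of `K` with carrier `ordSet S` — closed under `+`, `*`
because `S ∈ basePts` is REGULAR, so that the `𝔪_S`-adic order is a valuation
(`add_mem_ordSet`, `mul_mem_ordSet`, `…OrdValuation.lean`, ZS II VIII §1 Thm 1) — which dominates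
`S` (`dominates_ordSet_self`).

References: J. Lipman, Publ. IHÉS 36 (1969) §18 [`Lipman1969`]; M. Spivakovsky, Ann. of Math. 131
(1990) §II [`Spivakovsky1990`]; O. Zariski, P. Samuel, Commutative Algebra II (1960), Ch. VIII §1 and
Appendix 5 [`ZariskiSamuel1960`].
-/

noncomputable section

-- single-problem summit: the doubled namespace component `ResolutionOfSingularities` is forced
set_option linter.dupNamespace false

namespace Summit.ResolutionOfSingularities.ResolutionOfSingularities.Theorems.NoZeno.SandwichCluster

open Summit.ResolutionOfSingularities.ResolutionOfSingularities.Theses.HomologicalConductor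
open Summit.ResolutionOfSingularities.ResolutionOfSingularities.Theorems.NoZeno.Birth

variable {k K : Type} [Field k] [Field K] [Algebra k K]

/-- **No new base point (⊆ half of S4 `stub_basePtsStrictAnti`).**  Let `k ⊆ O`, `A ⊆ O`,
`Frac R = K`, and assume (Q_val at `m`): the cohomology annihilator `ca(T_m)` of the stage
`T_m = tower O A m` generates a principal ideal in every regular local `k`-subalgebra `S ⊇ T_m` of
`K`.  Then every base point of `T_(m+1)` over `R` is a base point of `T_m`:
`basePts R (tower O A (m + 1)) ⊆ basePts R (tower O A m)`.
(A base point `S` of `T_(m+1)` is regular, so `ordSet S` is a subsemiring of `K` — the order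
valuation ring `E_S` — dominating `S`; were `T_m ≤ S`, CAPTURE would force `T_(m+1) ≤ S`; and
`E_S` dominates `T_m ≤ T_(m+1)` because stages are `O`-local.)
[cite: Lipman1969, §18; Spivakovsky1990, §II; ZariskiSamuel1960, Ch. VIII §1 Thm. 1] -/
theorem basePts_tower_succ_subset (O : ValuationSubring K) (A R : Subalgebra k K)
    (hk : ∀ c : k, algebraMap k K c ∈ O) (hAO : A.toSubring ≤ O.toSubring) [IsFractionRing ↥R K]
    (m : ℕ)
    (hQ : ∀ S : Subalgebra k K, tower O A m ≤ S → IsRegularLocalRing ↥S →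
      (Ideal.span {s : ↥S | (s : K) ∈ ca (tower O A m)}).IsPrincipal) :
    basePts R (tower O A (m + 1)) ⊆ basePts R (tower O A m) := by
  intro S hS
  haveI : IsRegularLocalRing ↥S := hS.2.1
  -- the order valuation ring of `S`, as a subsemiring of `K` with carrier `ordSet S`
  let V : Subsemiring K :=
    { carrier := ordSet S
      zero_mem' := zero_mem_ordSet S
      one_mem' := one_mem_ordSet S
      add_mem' := add_mem_ordSet S
      mul_mem' := mul_mem_ordSet S }
  exact basePt_descends O A hk hAO m V R S ‹IsFractionRing ↥R K› hQ (dominates_ordSet_self S) hS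

/-- **No new base point, `SandwichCtx` form**: in a sandwich context `SandwichCtx O A R m₀`, under
(Q_val at `m`), `basePts R (tower O A (m + 1)) ⊆ basePts R (tower O A m)` — for EVERY `m`
(neither `m₀ + 1 ≤ m`, nor non-emptiness of `basePts`, nor singularity of `T_(m+1)` is needed for
this half of S4). [cite: Lipman1969, §18; Spivakovsky1990, §II] -/
theorem basePts_tower_succ_subset_of_sandwichCtx (O : ValuationSubring K) (A R : Subalgebra k K)
    (m₀ : ℕ) (ctx : SandwichCtx O A R m₀) (m : ℕ)
    (hQ : ∀ S : Subalgebra k K, tower O A m ≤ S → IsRegularLocalRing ↥S →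
      (Ideal.span {s : ↥S | (s : K) ∈ ca (tower O A m)}).IsPrincipal) :
    basePts R (tower O A (m + 1)) ⊆ basePts R (tower O A m) := by
  obtain ⟨hk, -, -, hAO, -, -, hRfr, -⟩ := ctx
  haveI := hRfr
  exact basePts_tower_succ_subset O A R hk hAO m hQ

end Summit.ResolutionOfSingularities.ResolutionOfSingularities.Theorems.NoZeno.SandwichCluster

end
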